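import Literature.Computability.Cryptography.HallgrenCombTable
import Literature.Computability.Cryptography.PseudoPeriodicCorrMassW
import HarnessLib

/-!
# Fourier sampling of a blurred gap table: the autocorrelation mass at the harmonics of the pitch

Topic `Computability/Cryptography`; joins `HallgrenCombTable.lean` (`BlurredGapTable`: the
finite-precision table of Hallgren's periodic function — level sets through GOOD starts are exact
combs with tooth tolerance `2w`, few starts are bad) to `PseudoPeriodicCorrMassW.lean` (the
autocorrelation mass of a table whose level sets are `W`-combs, `corrMass_ge_of_combsW`).
Theorem-and-definition file, no named facts. For a blurred gap table `T` read on `ℕ` (`T.FN`):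

* `isCombW_of_good` — the level set on `[0, Q)` through a good start `0 ≤ k < S − 2w` is a
  `(2w + 1)`-comb of `teethCount k m₀ Q ≥ Q/S − 1` teeth (`teethCount_ge`);
* `goodStarts T` — the good starts of the first window `[0, ⌊S − 2w⌋)` — is a set of injectivity of
  the table (`injOn_goodStarts`) of size `≥ ⌊S − 2w⌋ − n((S + 2μ)/S + 1)(2μ + 1)`, `μ = 2w + e`
  (`card_goodStarts_ge`, from Jozsa's count of the bad starts `card_filter_not_good_le`);
* **`corrMass_harmonic_ge`** (Jozsa 2003 §10, Thm. 6 with Lemma 3, for the BLURRED table): at a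
  character `c` within `1/2` of the `k`-th harmonic `kQ/S`, `30 k (2w+1) ≤ S`,
  `corrMass Q T.FN c ≥ #goodStarts · ((⌊Q/S⌋ − 1)/12)²`;
* `PeriodFinding.corrMass_congr_rel` — the mass only depends on the level-set relation on `[0, Q)` (so it transfers to
  any injective re-coding of the values, e.g. the bit tuples read by the oracle gates).

## References

* R. Jozsa, *Notes on Hallgren's efficient quantum algorithm for solving Pell's equation*,
  arXiv:quant-ph/0302134 (2003), §10 (Definition, Prop. 36, Thm. 6, Lemma 3). [Jozsa2003]
* S. Hallgren, J. ACM 54 (2007), Art. 4, §3–§4. [Hallgren2007]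
-/

noncomputable section

open scoped Classical

namespace Literature.Computability.Cryptography

open Finset PeriodFinding

namespace PeriodFinding

/-- **The autocorrelation mass only depends on the level-set relation on `[0, Q)`.** [folklore] -/
theorem corrMass_congr_rel {Ω Ω' : Type*} [DecidableEq Ω] [DecidableEq Ω'] {Q : ℕ} {F : ℕ → Ω} {F' : ℕ → Ω'}
    (h : ∀ v < Q, ∀ v' < Q, (F v = F v' ↔ F' v = F' v')) (c : ℤ) : corrMass Q F c = corrMass Q F' c := by
  apply Complex.ofReal_injective
  rw [corrMass_eq_sum_pairs, corrMass_eq_sum_pairs]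
  refine sum_congr rfl fun v hv => sum_congr rfl fun v' hv' => ?_
  rw [mem_range] at hv hv'
  by_cases hF : F v = F v'
  · rw [if_pos hF, if_pos ((h v hv v' hv').1 hF)]
  · rw [if_neg hF, if_neg (fun h' => hF ((h v hv v' hv').2 h'))]

end PeriodFinding

namespace BlurredGapTable

variable {α : Type*} (T : BlurredGapTable α)

/-- The table read on the naturals. [folklore] -/
def FN (v : ℕ) : α × ℤ := T.F v

/-! ### Level sets through good starts are `(2w+1)`-combs -/

/-- **The level set on `[0, Q)` through a good start `0 ≤ k < S − 2w` is a `(2w + 1)`-comb** with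
`teethCount` teeth. [cite: Jozsa2003, §10 (Definition of weak periodicity; proof of Thm. 6)] -/
theorem isCombW_of_good {k m₀ : ℤ} (h : T.IsGood k m₀) (hk0 : 0 ≤ k) (hk : (k : ℝ) < T.S - 2 * T.w) (Q : ℕ) :
    IsCombW Q T.S (2 * T.w + 1) T.FN k.toNat (T.teethCount k m₀ Q) := by
  have hS : 2 * T.w < T.S := by linarith [(show (0 : ℝ) ≤ k by exact_mod_cast hk0)]
  have hkc : ((k.toNat : ℕ) : ℝ) = (k : ℝ) := by exact_mod_cast Int.toNat_of_nonneg hk0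
  refine ⟨fun l => (T.tooth k m₀ l).toNat, fun l _ => ?_, T.injOn_tooth_toNat hk0 hS _, ?_⟩
  · rw [hkc]
    have := T.abs_tooth_toNat_sub_le (m₀ := m₀) hk0 hS l
    linarith
  · have hFk : T.FN k.toNat = T.F k := by unfold FN; rw [Int.toNat_of_nonneg hk0]
    have : (range Q).filter (fun v : ℕ => T.FN v = T.FN k.toNat) = (range Q).filter (fun v : ℕ => T.F v = T.F k) := by
      refine filter_congr fun v _ => ?_
      rw [hFk]; rfl
    rw [this]
    convert T.filter_range_eq_image h hk0 hk Q using 2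

/-- **The number of teeth is at least `Q/S − 1`** (for a start `k < S − 2w`).
[cite: Jozsa2003, §10 Thm. 6 (q = pS + r, p teeth)] -/
theorem teethCount_ge {k m₀ : ℤ} (hk : (k : ℝ) < T.S - 2 * T.w) (Q : ℕ) :
    (Q : ℝ) / T.S - 1 ≤ T.teethCount k m₀ Q := by
  have h := T.le_teethCount k m₀ Q
  have hS := T.S_pos
  rw [div_sub_one hS.ne', div_le_iff₀ hS]
  nlinarith

/-- The integer floor form: `⌊Q/S⌋ − 1 ≤ teethCount`. [folklore] -/
theorem pmin_le_teethCount {k m₀ : ℤ} (hk : (k : ℝ) < T.S - 2 * T.w) (Q : ℕ) :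
    ⌊(Q : ℝ) / T.S⌋₊ - 1 ≤ T.teethCount k m₀ Q := by
  have h := T.teethCount_ge (m₀ := m₀) hk Q
  have hfl : (⌊(Q : ℝ) / T.S⌋₊ : ℝ) ≤ (Q : ℝ) / T.S := Nat.floor_le (by have := T.S_pos; positivity)
  have : ((⌊(Q : ℝ) / T.S⌋₊ : ℕ) : ℝ) - 1 ≤ T.teethCount k m₀ Q := by linarith
  have : (⌊(Q : ℝ) / T.S⌋₊ : ℤ) - 1 ≤ (T.teethCount k m₀ Q : ℤ) := by exact_mod_cast this
  omega

/-! ### The good starts of the first window -/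

/-- The width `B = ⌊S − 2w⌋` of the window of starts. [folklore] -/
def B : ℕ := ⌊T.S - 2 * T.w⌋₊

/-- **The good starts** of the window `[0, B)`. [cite: Jozsa2003, §10 Prop. 36 (iii)] -/
def goodStarts : Finset ℕ := (range T.B).filter fun k : ℕ => ∃ m, T.IsGood (k : ℤ) m

/-- Good starts are below `S − 2w`. [folklore] -/
theorem lt_of_mem_goodStarts {k : ℕ} (hk : k ∈ T.goodStarts) : (k : ℝ) < T.S - 2 * T.w := by
  have hkB : k < T.B := mem_range.1 (mem_filter.1 hk).1
  have hB0 : 0 < T.B := by omega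
  have hpos : 0 < T.S - 2 * T.w := by
    by_contra hle
    push Not at hle
    have : T.B = 0 := Nat.floor_of_nonpos hle
    omega
  calc (k : ℝ) ≤ (T.B : ℝ) - 1 := by
        have : (k : ℝ) + 1 ≤ T.B := by exact_mod_cast hkB
        linarith
    _ < T.S - 2 * T.w := by
        have := Nat.floor_le hpos.le
        unfold B; linarith

/-- Two good starts of the window are less than `S − 2w` apart. [folklore] -/
theorem abs_sub_lt_of_mem_goodStarts {k k' : ℕ} (hk : k ∈ T.goodStarts) (hk' : k' ∈ T.goodStarts) :
    |(k' : ℝ) - k| < T.S - 2 * T.w := by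
  have h1 := T.lt_of_mem_goodStarts hk
  have h2 := T.lt_of_mem_goodStarts hk'
  have h3 : (0 : ℝ) ≤ k := Nat.cast_nonneg _
  have h4 : (0 : ℝ) ≤ k' := Nat.cast_nonneg _
  rw [abs_lt]; constructor <;> linarith

/-- **The table is injective on the good starts of the window.** [cite: Jozsa2003, §10 Prop. 36 (i)] -/
theorem injOn_goodStarts : Set.InjOn T.FN (T.goodStarts : Set ℕ) := by
  intro k hk k' hk' hF
  have hinj := T.injOn_of_good {z : ℤ | ∃ j : ℕ, j ∈ T.goodStarts ∧ z = j}
    (by rintro _ ⟨j, hj, rfl⟩; exact (mem_filter.1 hj).2)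
    (by
      rintro _ ⟨j, hj, rfl⟩ _ ⟨j', hj', rfl⟩
      exact_mod_cast T.abs_sub_lt_of_mem_goodStarts hj hj')
  have := hinj ⟨k, hk, rfl⟩ ⟨k', hk', rfl⟩ hF
  exact_mod_cast this

/-- **Most starts of the window are good**: `#goodStarts ≥ B − n((B + 2μ)/S + 1)(2μ + 1)`,
`μ = 2w + e`. [cite: Jozsa2003, §10 Prop. 36 (iii) (the exceptional set has density ≤ 1/poly)] -/
theorem card_goodStarts_ge :
    (T.B : ℝ) - T.n * (((T.B : ℝ) + 2 * (2 * T.w + T.e)) / T.S + 1) * (2 * (2 * T.w + T.e) + 1) ≤ T.goodStarts.card := by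
  have hbad := T.card_filter_not_good_le 0 T.B (by positivity)
  simp only [Int.cast_natCast, Int.cast_zero, sub_zero] at hbad
  -- the bad starts of the window, as naturals
  have hsplit : T.goodStarts.card + ((range T.B).filter fun k : ℕ => ∀ m, ¬ T.IsGood (k : ℤ) m).card = T.B := by
    have := card_filter_add_card_filter_not (s := range T.B) (p := fun k : ℕ => ∃ m, T.IsGood (k : ℤ) m)
    simp only [not_exists, card_range] at this
    exact this
  have hle : (((range T.B).filter fun k : ℕ => ∀ m, ¬ T.IsGood (k : ℤ) m).card : ℝ) ≤
      (((Finset.Ico (0 : ℤ) T.B).filter fun k => ∀ m, ¬ T.IsGood k m).card : ℝ) := by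
    have : ((range T.B).filter fun k : ℕ => ∀ m, ¬ T.IsGood (k : ℤ) m).card ≤
        ((Finset.Ico (0 : ℤ) T.B).filter fun k => ∀ m, ¬ T.IsGood k m).card := by
      refine card_le_card_of_injOn (fun k : ℕ => (k : ℤ)) (fun k hk => ?_) (fun a _ b _ h => ?_)
      · rw [mem_coe, mem_filter, mem_range] at hk
        rw [mem_coe, mem_filter, Finset.mem_Ico]
        refine ⟨⟨by positivity, ?_⟩, hk.2⟩
        have := hk.1
        show (k : ℤ) < (T.B : ℤ)
        exact_mod_cast this
      · have h' : (a : ℤ) = (b : ℤ) := h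
        exact_mod_cast h'
    exact_mod_cast this
  have hcast : (T.goodStarts.card : ℝ) + ((range T.B).filter fun k : ℕ => ∀ m, ¬ T.IsGood (k : ℤ) m).card = T.B := by
    exact_mod_cast hsplit
  linarith

/-! ### The mass at the harmonics -/

/-- **The autocorrelation mass of a blurred gap table at the harmonics of its pitch** (Jozsa's
Thm. 6 with Lemma 3, made robust to the blur): at a character `c` within `1/2` of `kQ/S`, with
`30 k (2w + 1) ≤ S`, `100 (2w+1) ≤ Q` and `5S + 5(2w+1) ≤ Q`,
`corrMass Q T.FN c ≥ #goodStarts · ((⌊Q/S⌋ − 1)/12)²`. [cite: Jozsa2003, §10 Thm. 6 and Lemma 3] -/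
theorem corrMass_harmonic_ge {Q k : ℕ} {c : ℤ} (hS : 1 ≤ T.S) (hQ : 100 * (2 * T.w + 1) ≤ Q)
    (hQS : 5 * T.S + 5 * (2 * T.w + 1) ≤ Q) (hk : 30 * (k : ℝ) * (2 * T.w + 1) ≤ T.S)
    (hc : |(c : ℝ) - k * Q / T.S| ≤ 1 / 2) :
    (T.goodStarts.card : ℝ) * (((⌊(Q : ℝ) / T.S⌋₊ - 1 : ℕ) : ℝ) / 12) ^ 2 ≤ corrMass Q T.FN c := by
  have hw1 : 1 ≤ 2 * T.w + 1 := by linarith [T.w_nonneg]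
  refine corrMass_ge_of_combsW T.goodStarts hS hw1 hQ hQS hk hc (fun v₀ hv₀ => ?_) T.injOn_goodStarts
    (fun v₀ hv₀ => ?_)
  · have h1 := T.lt_of_mem_goodStarts hv₀
    have : (v₀ : ℝ) < Q := by linarith [T.w_nonneg]
    exact_mod_cast this
  · obtain ⟨m₀, hgood⟩ := (mem_filter.1 hv₀).2
    have hlt := T.lt_of_mem_goodStarts hv₀
    refine ⟨T.teethCount v₀ m₀ Q, T.pmin_le_teethCount (m₀ := m₀) (by exact_mod_cast hlt) Q, ?_⟩
    have := T.isCombW_of_good hgood (by positivity) (by exact_mod_cast hlt) Q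
    simpa using this

end BlurredGapTable

end Literature.Computability.Cryptography

end
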